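import Summits.AtomisticToContinuum.Crystallization.Theorems.BrittleRungDescentMieRungReduction
import Summits.AtomisticToContinuum.Crystallization.Theorems.BrittleRungDescentMieRungCensusBounds
import Literature.MathematicalPhysics.StatisticalMechanics.BarlowCoordination

/-!
# Route `ContactSaturationLadder`, item `LooseTextureRung` (stmt-AtomisticToContinuum-30303):
# the competitor grade `γ = 1/2` — `E_LJ(N) ≤ (−1/2 + ε)·N` eventually

Helper file for the SPARSE ladder of the `LooseTextureRung` decomposition (lineage
`decomp-a2c-lens-1`, node §45/§47; land twins `ContactSaturationLadderSparseCut`,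
`…SparseRungOne`).  The rung-`m` exclusion `UnmarkedChunkExclusionF (coordMarker m) δ` closes from
a shell-sum bound `S(m)` and a **competitor** `γ` with `(m − 1)/24 + S(m)/12 < γ`, where a
competitor of grade `γ` is the asymptotic energy bound

  `Competitor γ := ∀ ε > 0, ∃ n₀, ∀ n ≥ n₀, E_LJ(n) ≤ (−γ + ε)·n`

(`E_LJ = groundStateEnergy lennardJones 3`).  This file proves the grade `γ = 1/2` OUTRIGHT from
modules the farm has built:

* `energyPerParticle_fccUnit_lennardJones_le` — the unit fcc configuration (the tree's
  `fccPeriodicConfiguration`, `a = 1`, `h = √(2/3)`) has Lennard-Jones energy per particle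
  `≤ −1/2`: twelve neighbours at the well `V(1) = −1/12` (`ncard_touching_eq_twelve`), every other
  lattice point at distance `≥ 1` where `V ≤ 0` (`le_dist_of_mem_barlowStacking_ideal`); this is
  the `q = 6` instance of `MieRungCoordination.energyPerParticle_fccUnit_le`
  (`…BrittleRungDescentMieRungCensusBounds`), re-proved here against `miePotential 6` so that the
  file does not depend on that (currently unbuilt) module;
* `eventually_groundStateEnergy_lennardJones_div_le` — `E_LJ(N)/N ≤ −1/2 + ε` eventually, from the
  trial-state half of the thermodynamic limit
  (`MieRungEnergetic.eventually_groundStateEnergy_div_le`, `…MieRungLimit`) and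
  `miePotential_six : miePotential 6 = lennardJones`;
* `competitor_half` — the def-free unfolding of `Competitor (1/2)`.

With the land twin `ContactSaturationLadderSparseRungOne.sparse_one_of_competitor` this makes the
rung `m = 1` of the SPARSE ladder (`UnmarkedChunkExclusionF (coordMarker 1) δ`, every `δ`) a
tree theorem with no open hypothesis.

All `[folklore]` (Blanc–Lewin 2015 §1.3, §2.2; Hales, *Dense Sphere Packings* §1.3 for fcc).
No new definitions, instances or notation.
-/

noncomputable section

open scoped BigOperators Topology
open Filter Set Metric

-- landed by prover hand 1, gen 11 (--supports 30303): gate dedup delta — `fccUnit_points`, `fccUnit_motif`, `sqrt_two_thirds_ne_zero`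
-- are CITED from `MieRungCoordination` (…BrittleRungDescentMieRungCensusBounds) instead of restated; the other declarations are byte-identical.
namespace Summit.AtomisticToContinuum.Crystallization.Theorems.ContactSaturationLadderCompetitorHalf

open Literature.MathematicalPhysics.StatisticalMechanics
open Summit.AtomisticToContinuum.Crystallization.Theorems.MieRungCoordination (fccUnit_points sqrt_two_thirds_ne_zero fccUnit_motif)
open Summit.AtomisticToContinuum.Crystallization.Theorems.MieRungEnergetic

/-! ### The unit fcc trial state under Lennard-Jones -/

/-- **The unit fcc trial energy under Lennard-Jones**: the energy per particle of the unit fcc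
configuration under `miePotential 6` (`= lennardJones`) is at most `−1/2` — twelve nearest
neighbours at the well `V(1) = −1/12`, all other lattice points at distance `≥ 1` where `V ≤ 0`.
(The `q = 6` case of `MieRungCoordination.energyPerParticle_fccUnit_le`.) [folklore] -/
theorem energyPerParticle_fccUnit_miePotential_six_le :
    (fccPeriodicConfiguration (a := 1) (h := Real.sqrt (2 / 3)) one_ne_zero
        sqrt_two_thirds_ne_zero).energyPerParticle (miePotential 6) ≤ -(1 / 2 : ℝ) := by
  classical
  set fccUnit := fccPeriodicConfiguration (a := 1) (h := Real.sqrt (2 / 3)) one_ne_zero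
    sqrt_two_thirds_ne_zero with hfccUnit
  have hq : 6 ≤ 6 := le_rfl
  have hq0 : (6 : ℕ) ≠ 0 := by norm_num
  set h : ℝ := Real.sqrt (2 / 3) with hh_def
  have hh : h ^ 2 = 2 / 3 * (1 : ℝ) ^ 2 := by rw [hh_def, Real.sq_sqrt (by norm_num)]; ring
  set x₀ : EuclideanSpace ℝ (Fin 3) := barlowPos 1 h constHagg ((0 : ℕ) : ℤ) 0 0 with hx₀
  have hx₀mem : x₀ ∈ barlowStacking 1 h constHagg := barlowPos_mem _ _ _
  -- the twelve touching points, as a finset of the index subtype of the lattice sum at `x₀`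
  set T : Set (EuclideanSpace ℝ (Fin 3)) := {w | w ∈ barlowStacking 1 h constHagg ∧ dist x₀ w = 1}
    with hT
  have hT12 : T.ncard = 12 := ncard_touching_eq_twelve isHaggSeq_const one_pos hh hx₀mem
  have hTfin : T.Finite := Set.finite_of_ncard_ne_zero (by rw [hT12]; norm_num)
  set S := {y : EuclideanSpace ℝ (Fin 3) // y ∈ fccUnit.points ∧ y ≠ x₀} with hS
  have hmemS : ∀ w ∈ T, w ∈ fccUnit.points ∧ w ≠ x₀ := by
    intro w hw
    refine ⟨by rw [fccUnit_points]; exact hw.1, fun h0 => ?_⟩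
    have := hw.2
    rw [h0, dist_self] at this
    exact zero_ne_one this
  set s₀ : Finset S := hTfin.toFinset.subtype fun y => y ∈ fccUnit.points ∧ y ≠ x₀ with hs₀
  have hs₀card : s₀.card = 12 := by
    rw [hs₀, Finset.card_subtype, Finset.filter_true_of_mem (fun w hw => hmemS w
      (hTfin.mem_toFinset.1 hw)), ← Set.ncard_eq_toFinset_card T hTfin, hT12]
  have hs₀dist : ∀ y ∈ s₀, dist x₀ y.1 = 1 := by
    intro y hy
    rw [hs₀, Finset.mem_subtype] at hy
    exact ((hTfin.mem_toFinset).1 hy).2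
  -- the lattice sum at `x₀` is at most the sum over the twelve touching points
  set f : S → ℝ := fun y => miePotential 6 (dist x₀ y.1) with hf
  have hsum : Summable f :=
    summable_dist (V := miePotential 6) (A := 1 / 6)
      (fun r hr => LadderGroundStates.miePotential_nonpos hq0 hr)
      (fun r hr => neg_six_le_miePotential hq hr) (by norm_num) fccUnit x₀
  have hsign : ∀ y ∉ s₀, 0 ≤ (fun b => -f b) y := by
    intro y _
    have hy1 : (1 : ℝ) ≤ dist x₀ y.1 := by
      have hpts : ∀ z : EuclideanSpace ℝ (Fin 3), z ∈ fccUnit.points →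
          z ∈ barlowStacking 1 h constHagg := fun z hz => by rwa [fccUnit_points] at hz
      have hyS : y.1 ∈ barlowStacking 1 h constHagg := hpts _ y.2.1
      exact le_dist_of_mem_barlowStacking_ideal isHaggSeq_const one_pos hh hx₀mem hyS
        (Ne.symm y.2.2)
    simp only [hf, neg_nonneg]
    exact LadderGroundStates.miePotential_nonpos hq0 hy1
  have h1 := sum_le_hasSum s₀ hsign hsum.hasSum.neg
  rw [Finset.sum_neg_distrib] at h1
  have htsum : (∑' y : S, f y) ≤ ∑ y ∈ s₀, f y := by linarith
  have hs₀sum : ∑ y ∈ s₀, f y = 12 * (-1 / (2 * ((6 : ℕ) : ℝ))) := by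
    have hterm : ∀ y ∈ s₀, f y = -1 / (2 * ((6 : ℕ) : ℝ)) := fun y hy => by
      simp only [hf]
      rw [hs₀dist y hy, miePotential_one hq0]
    rw [Finset.sum_congr rfl hterm, Finset.sum_const, hs₀card, nsmul_eq_mul]
    norm_num
  -- assemble
  unfold PeriodicConfiguration.energyPerParticle
  rw [fccUnit_motif, Finset.card_singleton, Finset.sum_singleton]
  have key : (∑' y : S, f y) ≤ -(1 : ℝ) := by
    rw [hs₀sum] at htsum
    have : 12 * (-1 / (2 * ((6 : ℕ) : ℝ))) = -(1 : ℝ) := by push_cast; norm_num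
    linarith
  have hcast : ((1 : ℕ) : ℝ) = 1 := by norm_num
  rw [hcast]
  calc (2 * (1 : ℝ))⁻¹ * ∑' y : S, f y ≤ (2 * (1 : ℝ))⁻¹ * (-(1 : ℝ)) :=
        mul_le_mul_of_nonneg_left key (by norm_num)
    _ = -(1 / 2 : ℝ) := by ring

/-! ### The competitor grade `γ = 1/2` -/

/-- **`E_LJ(N)/N ≤ −1/2 + ε` eventually** (`ε > 0`): the unit fcc configuration is a periodic
trial state with energy per particle `≤ −1/2`, and `E_V(N)/N` is eventually below every periodic
energy per particle plus `ε` (`MieRungEnergetic.eventually_groundStateEnergy_div_le`, applied to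
`V = miePotential 6 = lennardJones` with decay constant `A = 1/6` and stability constant
`C = 31250/6`). [folklore] -/
theorem eventually_groundStateEnergy_lennardJones_div_le {ε : ℝ} (hε : 0 < ε) :
    ∀ᶠ N : ℕ in atTop, groundStateEnergy lennardJones 3 N / N ≤ -(1 / 2 : ℝ) + ε := by
  have hq : 6 ≤ 6 := le_rfl
  have hq0 : (6 : ℕ) ≠ 0 := by norm_num
  have h := eventually_groundStateEnergy_div_le (V := miePotential 6) (A := 1 / 6)
    (C := 31250 / ((6 : ℕ) : ℝ)) (LadderGroundStates.miePotential_zero 6)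
    (fun r hr => LadderGroundStates.miePotential_nonpos hq0 hr)
    (fun r hr => neg_six_le_miePotential hq hr) (by norm_num) (le_interactionEnergy_miePotential hq)
    (fccPeriodicConfiguration (a := 1) (h := Real.sqrt (2 / 3)) one_ne_zero sqrt_two_thirds_ne_zero)
    hε
  rw [miePotential_six] at h
  filter_upwards [h] with N hN
  have hfcc := energyPerParticle_fccUnit_miePotential_six_le
  rw [miePotential_six] at hfcc
  exact hN.trans (by linarith)

/-- **The competitor grade `γ = 1/2`** (`Competitor (1/2)` of the SPARSE ladder, unfolded):
for every `ε > 0` there is `n₀` with `E_LJ(n) ≤ (−1/2 + ε)·n` for all `n ≥ n₀`. [folklore] -/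
theorem competitor_half :
    ∀ ε : ℝ, 0 < ε → ∃ n₀ : ℕ, ∀ n : ℕ, n₀ ≤ n →
      groundStateEnergy lennardJones 3 n ≤ (-(1 / 2 : ℝ) + ε) * n := by
  intro ε hε
  obtain ⟨n₀, hn₀⟩ := Filter.eventually_atTop.mp (eventually_groundStateEnergy_lennardJones_div_le hε)
  refine ⟨max n₀ 1, fun n hn => ?_⟩
  have hn1 : 1 ≤ n := le_trans (le_max_right _ _) hn
  have hn0 : (0 : ℝ) < n := by exact_mod_cast hn1
  have h' := hn₀ n (le_trans (le_max_left _ _) hn)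
  rwa [div_le_iff₀ hn0] at h'

end Summit.AtomisticToContinuum.Crystallization.Theorems.ContactSaturationLadderCompetitorHalf

end
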